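import Literature.MathematicalPhysics.QuantumFieldTheory.Balaban1983to89.B9SectBL2GFrameV8
import Literature.MathematicalPhysics.QuantumFieldTheory.Balaban1983to89.B9SectBH1GFrameV6
import Literature.MathematicalPhysics.QuantumFieldTheory.Balaban1983to89.B9SectBE4H2GFrameV6
import Literature.MathematicalPhysics.QuantumFieldTheory.Balaban1983to89.B9SectBE4FrameCodedY

/-!
# `Balaban1983to89.B9SectBFrameGpSwap` — T. Bałaban, *Propagators for lattice gauge theories in a background field*, Commun. Math. Phys. **99** (1985) 389–434
# [Balaban1985BackgroundPropagators], Thm 3.4 p. 400 ∕ Sect. B pp. 400–407, read through the tree's LETTERS DICTIONARIES («frames»): RE-KEYING A FRAME TO ANOTHER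
# G′ FAMILY WITH THE SAME (3.42) BLOCK (pub-ymgap N06 [B9]; CASCADE-K step K1, the (C) road; bookkeeping)

statement-level skeleton of published theorems with citation tags; proofs where landed; nothing here is a claim about the Yang–Mills mass gap

THE PRINT.  Sect. B (pp. 400–407) derives the inequalities (3.42)–(3.48) for `G′(U′U)`, `(Q′G′²Q′*)⁻¹(U′U)`, `G(U′U)` from those at `U` («applying Theorem 3.1 for G′(U),
the inequalities (3.63), (3.64), and Lemma 2.1 of [4] we can prove all the statements (3.42)–(3.47) for the operator G′(U′U), of course with different constants»,
p. 402).  The tree types each such derivation as a FRAME — a structure of letters + laws over an abstract readings family `Gp i : B9.KernelFamily (geo i) (bg i)`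
(`B9SectBGpStepAtLettersV2.GpFrame₂` and its extensions `B9SectBKerFrameV3.CinvFrame₃`, `B9SectBGFrameV5.GFrame₅`, `B9SectBH1GFrameV6.H1GFrame₆`,
`B9SectBE4H2GFrameV6.E4H2GFrame₆`, `B9SectBL2GFrameV8.L2GFrame₈`, `B9SectBE4FrameCodedY.E4Frame₃`, `B9SectBGpStepAtLettersV2.AnFrame₂`) — and a generic theorem
`step…_of_…Frame…` per frame.

WHY THIS FILE (pub-ymgap node N06 [B9], director-ym №383 CASCADE-K, step K1 = this seat's lineage: the coded Sect.-B chain at the SPLIT transporters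
`(parA, parH)` of `B9SectBCodedReadingsUParH.KSCUPar`).  MEASURED (this seat, g24): in all the frames above the G′ family `Gp` is read ONLY through its (3.42) block
`EBlock (Gp i)` (`GpFrame₂.read342 ∕ .write342`), plus `L2GFrame₈.read377` (the (3.42) and (3.46) blocks), `E4Frame₃.e4_transfer` (the (3.42) and (3.44) blocks) and
`AnFrame₂.writeAn` (the analyticity predicate); `CinvFrame₃ ∕ GFrame₅ ∕ H1GFrame₆ ∕ E4H2GFrame₆` add no `Gp`-reading field.  Hence a frame built for one coded G′
family (the tree's `KSC par`, the (3.42)-augmented reading) SERVES VERBATIM any family with the same (3.42) [∕ (3.46) ∕ (3.44)] members — in K1: the two-transporter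
family `KSC₇Par parA parH` (successor module `B9SectBCodedFamiliesUParH`), whose (3.42)∕(3.44)∕(3.46)∕(3.47) members ARE `KSC parA`'s and whose Hölder members (3.43)∕(3.45)
are `KSCUPar parA parH`'s.  THIS FILE is the re-keying, once, generically:
* ★ `GpFrame₂.swapGp F Gp' hE` — `F : GpFrame₂ … Gp …` re-keyed to `Gp'` given `hE : ∀ i B δ V, EBlock (Gp' i) B δ V ↔ EBlock (Gp i) B δ V`; every datum and
  every other law of `F` unchanged (so all thresholds ∕ constants `MInv aInv aW cR wB wδ δcap M261 MST …` are `F`'s, definitionally: `swapGp_MInv`, `swapGp_M261`);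
* ★ `CinvFrame₃.swapGp`, ★ `GFrame₅.swapGp`, ★ `H1GFrame₆.swapGp`, ★ `E4H2GFrame₆.swapGp` — the same through the `extends` chain (no further `Gp` field);
* ★ `L2GFrame₈.swapGp F Gp' hE hL` — additionally `hL : ∀ i B δ V, L2Block (Gp' i) B δ V ↔ L2Block (Gp i) B δ V` (field `read377`);
* ★ `E4Frame₃.swapGp F Gp' hE hE4` — additionally `hE4 : ∀ i Bε δ V, E4Block (Gp' i) Bε δ V ↔ E4Block (Gp i) Bε δ V` (field `e4_transfer`);
* ★ `AnFrame₂.swapGp F Gp' hE hAn` — additionally `hAn : ∀ i V α₁, IsAnalyticExt i (Gp i) V α₁ → IsAnalyticExt i (Gp' i) V α₁` (field `writeAn`).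
The generic step theorems (`stepEPos_of_gpFrame₂`, `stepKerPos_of_cinvFrame₃`, `stepEPos_of_gFrame₅`, `stepH1Pos_of_h1GFrame₆`, `stepE4Pos ∕ stepH2Pos_of_e4h2GFrame₆`,
`stepL2Pos_of_l2GFrame₈`, `stepE4Pos_of_e4Frame₃`, `stepAnalyticPos1_of_anFrame₂`) then apply to the re-keyed frames as they stand.

HONEST SCOPE ∕ NOT CLAIMED.  Definitions only (structure updates re-proving two or three implication-shaped fields through the given `Iff`s) and two `rfl`
lemmas; nothing of [B9] asserted; count-neutral; N06 NOT discharged; nothing continuum ∕ OS ∕ mass gap ∕ Clay.  NEW file; no `sorry`, no `axiom`, no `instance`,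
no `notation`.  Cell `pub-ymgap` (D-0062), seat `pub-ymgap-dag-n06-c` (gen 24), 2026-08-30; `--supports stmt-QuantumFields-27364`.  Net new unproved facts: 0.

RELATED IN THE TREE, NOT DUPLICATED (searched 2026-08-30: `rg 'swapGp|reKey|rekeyGp' lean/Literature lean/Summits` — 0 hits): the frame structures and their step
theorems listed above (USED); the per-family bridges `eBlock_KSC₅_iff ∕ eBlock_KSC₆_iff ∕ eBlock_KSC₇_iff` of `B9SectBH1FrameCodedY ∕ B9SectBE4FrameCodedY ∕
B9SectBH2FrameCodedY` (the `hE` shape, single transporter).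
-/

noncomputable section

namespace Literature.MathematicalPhysics.QuantumFieldTheory.Balaban1983to89

open B9FromB6 (EBlock L2Block E4Block)

universe u

variable {I : Type} {c35 : ℝ} {geo : I → B9.Geometry} {bg : I → B9.Backgrounds} {Gp : ∀ i, B9.KernelFamily (geo i) (bg i)}
  {𝔸 : Type u} [NormedRing 𝔸] [NormedAlgebra ℂ 𝔸] [CompleteSpace 𝔸] {ι : Type} [Fintype ι] [DecidableEq ι]
  {b : Module.Basis ι ℝ 𝔸} {κ : Type} [Fintype κ]
  {S : I → Type} [∀ i, Fintype (S i)] [∀ i, DecidableEq (S i)]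
  [∀ i, Fintype (geo i).Site] [∀ i, DecidableEq (geo i).Site] [∀ i, Nonempty (geo i).Site]

/-! ## §1 The root frame -/

namespace B9SectBGpStepAtLettersV2.GpFrame₂

/-- ★ **RE-KEYING THE G′ ROOT FRAME TO A FAMILY WITH THE SAME (3.42) BLOCK**: every letter, constant, threshold and law of `F` kept; the two (3.42) dictionaries
`read342 ∕ write342` transported through `hE`. [cite: Balaban1985BackgroundPropagators, Thm 3.4 p.400, (3.42) p.397, p.403 («of course with different constants»); Balaban1984PropagatorsII, (2.51) p.232] -/
def swapGp (F : GpFrame₂ c35 geo bg Gp b κ S) (Gp' : ∀ i, B9.KernelFamily (geo i) (bg i))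
    (hE : ∀ i (B δ : ℝ) (V : (bg i).Cfg), EBlock (Gp' i) B δ V ↔ EBlock (Gp i) B δ V) : GpFrame₂ c35 geo bg Gp' b κ S :=
  { F with
    read342 := fun i α₀ U B₀ δ hM hα₀ hMa hU hB₀ hδ hEb => F.read342 i α₀ U B₀ δ hM hα₀ hMa hU hB₀ hδ ((hE i B₀ δ U).1 hEb)
    write342 := fun i U U' α₁ B δ hα₁ haW h37 hB hδ h0 h1 h2 h3 => (hE i _ _ _).2 (F.write342 i U U' α₁ B δ hα₁ haW h37 hB hδ h0 h1 h2 h3) }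

omit [CompleteSpace 𝔸] [DecidableEq ι] [∀ i, DecidableEq (S i)] [∀ i, Nonempty (geo i).Site] in
/-- the re-keyed frame's M-threshold for invertibility is `F`'s (`rfl`). [cite: Balaban1985BackgroundPropagators, Thm 3.4 p.400, bookkeeping] -/
theorem swapGp_MInv (F : GpFrame₂ c35 geo bg Gp b κ S) (Gp' : ∀ i, B9.KernelFamily (geo i) (bg i))
    (hE : ∀ i (B δ : ℝ) (V : (bg i).Cfg), EBlock (Gp' i) B δ V ↔ EBlock (Gp i) B δ V) : (F.swapGp Gp' hE).MInv = F.MInv := rfl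

omit [CompleteSpace 𝔸] [DecidableEq ι] [∀ i, DecidableEq (S i)] [∀ i, Nonempty (geo i).Site] in
/-- the re-keyed frame's [4]-Lemma-2.1 threshold function is `F`'s (`rfl`). [cite: Balaban1984PropagatorsII, Lemma 2.1 (2.59) p.233, bookkeeping] -/
theorem swapGp_M261 (F : GpFrame₂ c35 geo bg Gp b κ S) (Gp' : ∀ i, B9.KernelFamily (geo i) (bg i))
    (hE : ∀ i (B δ : ℝ) (V : (bg i).Cfg), EBlock (Gp' i) B δ V ↔ EBlock (Gp i) B δ V) : (F.swapGp Gp' hE).M261 = F.M261 := rfl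

end B9SectBGpStepAtLettersV2.GpFrame₂

/-! ## §2 The analytic-extension frame -/

namespace B9SectBGpStepAtLettersV2.AnFrame₂

/-- ★ re-keying the analytic-extension frame: `writeAn` transported through `hAn`. [cite: Balaban1985BackgroundPropagators, Thm 3.4 p.400, (3.62)–(3.64) p.402] -/
def swapGp {IsAnalyticExt : ∀ i, B9.KernelFamily (geo i) (bg i) → (bg i).Cfg → ℝ → Prop} (F : AnFrame₂ c35 geo bg Gp b κ S IsAnalyticExt)
    (Gp' : ∀ i, B9.KernelFamily (geo i) (bg i)) (hE : ∀ i (B δ : ℝ) (V : (bg i).Cfg), EBlock (Gp' i) B δ V ↔ EBlock (Gp i) B δ V)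
    (hAn : ∀ i (V : (bg i).Cfg) (α₁ : ℝ), IsAnalyticExt i (Gp i) V α₁ → IsAnalyticExt i (Gp' i) V α₁) :
    AnFrame₂ c35 geo bg Gp' b κ S IsAnalyticExt :=
  { F.toGpFrame₂.swapGp Gp' hE with
    writeAn := fun i α₀ U α₁ hM hα₀ hMa hU hα₁ haW hinv => hAn i U α₁ (F.writeAn i α₀ U α₁ hM hα₀ hMa hU hα₁ haW hinv) }

end B9SectBGpStepAtLettersV2.AnFrame₂

/-! ## §3 The (3.44) frame of G′ -/

namespace B9SectBE4FrameCodedY.E4Frame₃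

/-- ★ re-keying the (3.44) frame of G′: `e4_transfer` transported through `hE` and `hE4`. [cite: Balaban1985BackgroundPropagators, (3.44) p.398, Thm 3.4 p.400, p.403 l.2–5] -/
def swapGp (F : E4Frame₃ c35 geo bg Gp b κ S) (Gp' : ∀ i, B9.KernelFamily (geo i) (bg i))
    (hE : ∀ i (B δ : ℝ) (V : (bg i).Cfg), EBlock (Gp' i) B δ V ↔ EBlock (Gp i) B δ V)
    (hE4 : ∀ i (Bε : ℝ → ℝ) (δ : ℝ) (V : (bg i).Cfg), E4Block (Gp' i) Bε δ V ↔ E4Block (Gp i) Bε δ V) : E4Frame₃ c35 geo bg Gp' b κ S :=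
  { F.toGpFrame₂.swapGp Gp' hE with
    wE4 := F.wE4
    wE4δ := F.wE4δ
    wE4δ_pos := F.wE4δ_pos
    e4_transfer := fun i α₀ U U' α₁ B₀ B δ δc Bε hM hα₀ hMa hU hα₁ haW h37 hB₀ hB hδ hδc hδcδ hEb hE4b HV =>
      (hE4 i _ _ _).2 (F.e4_transfer i α₀ U U' α₁ B₀ B δ δc Bε hM hα₀ hMa hU hα₁ haW h37 hB₀ hB hδ hδc hδcδ ((hE i _ _ _).1 hEb) ((hE4 i _ _ _).1 hE4b) HV) }

end B9SectBE4FrameCodedY.E4Frame₃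

/-! ## §4 The (3.48) frame and the G-side frames over a block carrier -/

section Blk

variable {P : I → Type} [∀ i, Fintype (P i)] [∀ i, DecidableEq (P i)]

namespace B9SectBKerFrameV3.CinvFrame₃

/-- ★ re-keying the (G′, C⁻¹) frame (no `Gp`-reading field beyond the root frame's). [cite: Balaban1985BackgroundPropagators, Thm 3.2 (3.48) p.398, (3.65)–(3.67) p.403] -/
def swapGp {Cinv : ∀ i, B9.SiteKernel (geo i) (bg i)} (F : CinvFrame₃ c35 geo bg Gp b κ S P Cinv) (Gp' : ∀ i, B9.KernelFamily (geo i) (bg i))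
    (hE : ∀ i (B δ : ℝ) (V : (bg i).Cfg), EBlock (Gp' i) B δ V ↔ EBlock (Gp i) B δ V) : CinvFrame₃ c35 geo bg Gp' b κ S P Cinv :=
  { F with toGpFrame₂ := F.toGpFrame₂.swapGp Gp' hE }

end B9SectBKerFrameV3.CinvFrame₃

variable [LinearOrder κ]

namespace B9SectBGFrameV5.GFrame₅

/-- ★ re-keying the G-sector (3.42) frame (no `Gp`-reading field beyond the root frame's). [cite: Balaban1985BackgroundPropagators, Thm 3.3 p.399, Thm 3.4 p.400, (3.84)–(3.86) p.407] -/
def swapGp {GA : ∀ i, B9.KernelFamily (geo i) (bg i)} {Cinv : ∀ i, B9.SiteKernel (geo i) (bg i)} (F : GFrame₅ c35 geo bg Gp b κ S P GA Cinv)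
    (Gp' : ∀ i, B9.KernelFamily (geo i) (bg i)) (hE : ∀ i (B δ : ℝ) (V : (bg i).Cfg), EBlock (Gp' i) B δ V ↔ EBlock (Gp i) B δ V) :
    GFrame₅ c35 geo bg Gp' b κ S P GA Cinv :=
  { F with toCinvFrame₃ := F.toCinvFrame₃.swapGp Gp' hE }

end B9SectBGFrameV5.GFrame₅

namespace B9SectBH1GFrameV6.H1GFrame₆

/-- ★ re-keying the G-sector (3.43) frame. [cite: Balaban1985BackgroundPropagators, Thm 3.3 p.399, (3.43) p.398, Thm 3.4 p.400] -/
def swapGp {GA : ∀ i, B9.KernelFamily (geo i) (bg i)} {Cinv : ∀ i, B9.SiteKernel (geo i) (bg i)} (F : H1GFrame₆ c35 geo bg Gp b κ S P GA Cinv)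
    (Gp' : ∀ i, B9.KernelFamily (geo i) (bg i)) (hE : ∀ i (B δ : ℝ) (V : (bg i).Cfg), EBlock (Gp' i) B δ V ↔ EBlock (Gp i) B δ V) :
    H1GFrame₆ c35 geo bg Gp' b κ S P GA Cinv :=
  { F with toGFrame₅ := F.toGFrame₅.swapGp Gp' hE }

end B9SectBH1GFrameV6.H1GFrame₆

namespace B9SectBE4H2GFrameV6.E4H2GFrame₆

/-- ★ re-keying the G-sector (3.44)∕(3.45) frame. [cite: Balaban1985BackgroundPropagators, Thm 3.3 p.399, (3.44)–(3.45) p.398, Thm 3.4 p.400] -/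
def swapGp {GA : ∀ i, B9.KernelFamily (geo i) (bg i)} {Cinv : ∀ i, B9.SiteKernel (geo i) (bg i)} (F : E4H2GFrame₆ c35 geo bg Gp b κ S P GA Cinv)
    (Gp' : ∀ i, B9.KernelFamily (geo i) (bg i)) (hE : ∀ i (B δ : ℝ) (V : (bg i).Cfg), EBlock (Gp' i) B δ V ↔ EBlock (Gp i) B δ V) :
    E4H2GFrame₆ c35 geo bg Gp' b κ S P GA Cinv :=
  { F with toGFrame₅ := F.toGFrame₅.swapGp Gp' hE }

end B9SectBE4H2GFrameV6.E4H2GFrame₆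

namespace B9SectBL2GFrameV8.L2GFrame₈

/-- ★ re-keying the G-sector (3.46) frame: the displayed (3.77) field `read377` reads the (3.42) AND (3.46) blocks of G′, transported through `hE`, `hL`.
[cite: Balaban1985BackgroundPropagators, Thm 3.3 p.399, (3.46) p.398, (3.77) p.406, Thm 3.4 p.400] -/
def swapGp {GA : ∀ i, B9.KernelFamily (geo i) (bg i)} {Cinv : ∀ i, B9.SiteKernel (geo i) (bg i)} (F : L2GFrame₈ c35 geo bg Gp b κ S P GA Cinv)
    (Gp' : ∀ i, B9.KernelFamily (geo i) (bg i)) (hE : ∀ i (B δ : ℝ) (V : (bg i).Cfg), EBlock (Gp' i) B δ V ↔ EBlock (Gp i) B δ V)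
    (hL : ∀ i (B δ : ℝ) (V : (bg i).Cfg), L2Block (Gp' i) B δ V ↔ L2Block (Gp i) B δ V) : L2GFrame₈ c35 geo bg Gp' b κ S P GA Cinv :=
  { F with
    toGFrame₅ := F.toGFrame₅.swapGp Gp' hE
    read377 := fun B₀ δ₀ B₁ δ₁ hB₀ hδ₀ hB₁ hδ₁ =>
      match F.read377 B₀ δ₀ B₁ δ₁ hB₀ hδ₀ hB₁ hδ₁ with
      | ⟨M₇, a₇, κ₇, ρ₇, hM₇, ha₇, hκ₇, hρ₇, H⟩ => ⟨M₇, a₇, κ₇, ρ₇, hM₇, ha₇, hκ₇, hρ₇, fun i α₀ U hM hα₀ hMa hU hEb hLb hC α₁ U' hα₁ ha₁ h37 =>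
          H i α₀ U hM hα₀ hMa hU ((hE i _ _ _).1 hEb) ((hL i _ _ _).1 hLb) hC α₁ U' hα₁ ha₁ h37⟩ }

end B9SectBL2GFrameV8.L2GFrame₈

end Blk

end Literature.MathematicalPhysics.QuantumFieldTheory.Balaban1983to89

end
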